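import Summits.SmoothPoincare4.SmoothPoincare4.Theorems.ConvexBisectionSphereSeamStandard
import Mathlib.Geometry.Manifold.Diffeomorph
import Literature.Geometry.Symplectic.SteinFillingSphere
import Literature.Topology.FourManifolds.CerfGammaFour
import Literature.Topology.FourManifolds.ClosedBall
import Literature.Topology.FourManifolds.Cobordism
import Literature.Topology.FourManifolds.CorkDecomposition

/-!
# `SmoothSphereSeamStandard` — the smooth seam-`S³` endpoint of route ConvexBisection,
# conditionally on Eliashberg (1990) and Cerf (1968)
(item stmt-SmoothPoincare4-15001, support of route route-SmoothPoincare4-ConvexBisection)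

The item `SmoothSphereSeamStandard` (route-choice repair 2026-08-16 of the role of
`SphereSeamStandard`, stmt-SmoothPoincare4-10510): for every Hausdorff second countable smooth
`4`-manifold `M ≃ₕ S⁴` carrying a Stein bisection along a common contact seam — two compact Stein
domains `(W₁, J₁)`, `(W₂, J₂)` smoothly embedded by `e₁`, `e₂`, covering `M`, meeting exactly in
the images of both boundaries, with equal pushed-forward complex tangencies on the seam — such
that SOME boundary datum of `W₁` has carrier DIFFEOMORPHIC to the round `S³`, `M ≅ S⁴`.

Everything here concludes the item's statement AS A TERM (token for token the signature of
stmt-SmoothPoincare4-15001 / the body of the route definition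
`Summit.SmoothPoincare4.SmoothPoincare4.Theses.ConvexBisection.SmoothSphereSeamStandard`), so the
results apply verbatim to the route declaration by definitional unfolding.

* `smoothSphereSeamStandard_of_facts` — the item CONDITIONALLY on the two published theorems it
  rests on, both named facts (`def … : Prop`) of the tree taken as leading hypotheses and both
  theory-sized (undischarged):
  `Literature.Geometry.Symplectic.Eliashberg1990_steinFilling_sphere_three` (Eliashberg 1990,
  Thm. 5.1, with Eliashberg 1992, Thm. 2.1.1: a compact Stein domain bounded by a smooth `S³` is
  `𝔻⁴`) and `Literature.Topology.FourManifolds.cerf_twistedSphere_four` (Cerf 1968, `Γ₄ = 0`: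
  twisted spheres `𝔻⁴ ∪_χ 𝔻⁴` are `S⁴`).  Three lines over the landed
  `nonempty_diffeomorph_sphere_four_of_steinBisection_of_diffeomorph`
  (`Theorems/ConvexBisectionSphereSeamStandard.lean`): `W₁ ≅ 𝔻⁴` (Eliashberg), `∂W₂ ≅ ∂W₁ ≅ S³`
  by the seam diffeomorphism, `W₂ ≅ 𝔻⁴` (Eliashberg), `M = 𝔻⁴ ∪_χ 𝔻⁴ ≅ S⁴` (Cerf).  NO
  dimension-`3` recognition or smoothing theorem enters (the seam is handed over in the shape of
  Eliashberg's hypothesis); `M ≃ₕ S⁴` and the contact matching are not used.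
* `smoothSphereSeamStandard_of_sphereSeamStandard` — the item follows from the older support item
  `SphereSeamStandard` (seam HOMEOMORPHIC to `S³`) by pure topology: a boundary datum `b` of `W₁`
  is embedded onto `∂W₁`, so `b.carrier ≅ S³` gives `∂W₁ ≃ₜ S³`.
* `smoothSphereSeamStandard_of_smoothPoincare4` — the item is implied by the summit statement
  (refutable only by an exotic `S⁴`).
* `exists_boundaryData_diffeomorph_sphere_three_of_diffeomorph_closedBall` — the dictionary entry
  used by line Sketch of crux `PlanarAcyclicBisectionRigidity` (stmt-SmoothPoincare4-15086): a BALL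
  CERTIFICATE `W ≅ 𝔻⁴` of a half yields the item's seam hypothesis, a boundary datum of `W` with
  carrier `≅ S³` (restrict the certificate to the boundary, `BoundaryData.restrictDiffeomorph`, onto
  `∂𝔻⁴ = S³`, `closedBallBoundaryData 3`).
* `nonempty_diffeomorph_sphere_four_of_steinBisection_of_ballCertificate` — a Stein bisection one of
  whose halves carries a ball certificate is `S⁴`, modulo Eliashberg (once, for the other half) and
  Cerf.

## References

* Ya. Eliashberg, *Filling by holomorphic discs and its applications*, LMS Lecture Note Ser. 151
  (1990), Thm. 5.1. [Eliashberg1990]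
* Ya. Eliashberg, *Contact 3-manifolds twenty years since J. Martinet's work*, Ann. Inst. Fourier
  42 (1992), Thm. 2.1.1. [Eliashberg1992]
* J. Cerf, *Sur les difféomorphismes de la sphère de dimension trois (Γ₄ = 0)*, LNM 53 (1968).
  [CerfDiffeoSphere1968]
* M. Kervaire, J. Milnor, *Groups of homotopy spheres I*, Ann. of Math. 77 (1963), §1.
  [KervaireMilnor1963]
* C. Wendl, *Strongly fillable contact manifolds and `J`-holomorphic foliations*, Duke Math. J.
  151 (2010) (arXiv:0806.3193), Introduction p. 6. [Wendl2010]
-/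

noncomputable section

-- the prescribed namespace `Summit.<P>.<Sub>.…` duplicates `SmoothPoincare4` (P = Sub)
set_option linter.dupNamespace false

open scoped Manifold ContDiff Topology ContinuousMap
open Set Function Literature.Topology.FourManifolds Literature.Geometry.Symplectic

namespace Summit.SmoothPoincare4.SmoothPoincare4.Theorems

/-! ### Ball certificates and the seam hypothesis -/

/-- **A ball certificate yields the seam hypothesis of the item.**  If a `4`-manifold with
boundary `W` is diffeomorphic to the closed unit ball `𝔻⁴`, then some (indeed every) boundary
datum of `W` has carrier diffeomorphic to the round `S³`: restrict the certificate to the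
boundary (`BoundaryData.restrictDiffeomorph`, Lee 2013 Thm. 5.11/Cor. 5.30) onto the boundary
datum `∂𝔻⁴ = S³` of the ball (`closedBallBoundaryData 3`).  This is the dictionary entry
"ball certificate of the positive block ⟹ hypothesis (i′)" of line Sketch of crux
`PlanarAcyclicBisectionRigidity`. [folklore] -/
theorem exists_boundaryData_diffeomorph_sphere_three_of_diffeomorph_closedBall
    (W : Type) [TopologicalSpace W] [ChartedSpace (EuclideanHalfSpace 4) W]
    (b : BoundaryData (𝓡∂ 4) W (𝓡 3))
    (Φ : W ≃ₘ⟮𝓡∂ 4, 𝓡∂ 4⟯ Metric.closedBall (0 : EuclideanSpace ℝ (Fin 4)) 1) :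
    ∃ b : BoundaryData (𝓡∂ 4) W (𝓡 3),
      Nonempty (b.carrier ≃ₘ⟮𝓡 3, 𝓡 3⟯ Metric.sphere (0 : EuclideanSpace ℝ (Fin 4)) 1) :=
  ⟨b, ⟨b.restrictDiffeomorph (closedBallBoundaryData 3) Φ⟩⟩

/-! ### The item, conditionally on Eliashberg and Cerf -/

/-- **`SmoothSphereSeamStandard` modulo Eliashberg (1990) Thm. 5.1 and Cerf (1968) `Γ₄ = 0`.**
For every Hausdorff second countable smooth `4`-manifold `M ≃ₕ S⁴` with a Stein bisection
`M = e₁(W₁) ∪ e₂(W₂)` along a common contact seam such that some boundary datum of `W₁` has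
carrier diffeomorphic to `S³`, `M ≅ S⁴`.  The statement is, token for token, the signature of item
stmt-SmoothPoincare4-15001 (the body of the route definition
`Summit.SmoothPoincare4.SmoothPoincare4.Theses.ConvexBisection.SmoothSphereSeamStandard`).
Proof: unpack the witness and apply
`nonempty_diffeomorph_sphere_four_of_steinBisection_of_diffeomorph` (`W₁ ≅ 𝔻⁴` by Eliashberg,
`∂W₂ ≅ ∂W₁ ≅ S³` by the seam diffeomorphism, `W₂ ≅ 𝔻⁴` by Eliashberg, `𝔻⁴ ∪_χ 𝔻⁴ ≅ S⁴` by
Cerf); the homotopy equivalence and the contact matching are discarded.  CONDITIONAL result: the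
two hypotheses are undischarged published theorems of the tree; no dimension-`3` recognition or
smoothing theorem is used. [cite: Eliashberg1990, Thm. 5.1] [cite: KervaireMilnor1963, §1] -/
theorem smoothSphereSeamStandard_of_facts
    (hE : Eliashberg1990_steinFilling_sphere_three) (hCerf : cerf_twistedSphere_four) :
    ∀ (M : Type) [TopologicalSpace M] [T2Space M] [SecondCountableTopology M]
      [ChartedSpace (EuclideanSpace ℝ (Fin 4)) M] [IsManifold (𝓡 4) ∞ M],
      M ≃ₕ Metric.sphere (0 : EuclideanSpace ℝ (Fin 5)) 1 →
      (∃ (W₁ : Type) (_ : TopologicalSpace W₁) (_ : ChartedSpace (EuclideanHalfSpace 4) W₁)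
          (_ : IsManifold (𝓡∂ 4) ∞ W₁) (_ : CompactSpace W₁) (W₂ : Type) (_ : TopologicalSpace W₂)
          (_ : ChartedSpace (EuclideanHalfSpace 4) W₂) (_ : IsManifold (𝓡∂ 4) ∞ W₂)
          (_ : CompactSpace W₂) (J₁ : Literature.Geometry.Symplectic.SteinStructure W₁)
          (J₂ : Literature.Geometry.Symplectic.SteinStructure W₂) (e₁ : W₁ → M) (e₂ : W₂ → M),
          Manifold.IsSmoothEmbedding (𝓡∂ 4) (𝓡 4) ∞ e₁ ∧
            Manifold.IsSmoothEmbedding (𝓡∂ 4) (𝓡 4) ∞ e₂ ∧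
            Set.range e₁ ∪ Set.range e₂ = Set.univ ∧
            Set.range e₁ ∩ Set.range e₂ = e₁ '' (𝓡∂ 4).boundary W₁ ∧
            Set.range e₁ ∩ Set.range e₂ = e₂ '' (𝓡∂ 4).boundary W₂ ∧
            (∀ w₁ w₂, e₁ w₁ = e₂ w₂ →
              Submodule.map (mfderiv (𝓡∂ 4) (𝓡 4) e₁ w₁).toLinearMap
                  (Literature.Geometry.Symplectic.contactPlane J₁.J w₁) =
                Submodule.map (mfderiv (𝓡∂ 4) (𝓡 4) e₂ w₂).toLinearMap
                  (Literature.Geometry.Symplectic.contactPlane J₂.J w₂)) ∧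
            (∃ b : Literature.Topology.FourManifolds.BoundaryData (𝓡∂ 4) W₁ (𝓡 3),
              Nonempty (b.carrier ≃ₘ⟮𝓡 3, 𝓡 3⟯ Metric.sphere (0 : EuclideanSpace ℝ (Fin 4)) 1))) →
      Nonempty (M ≃ₘ⟮𝓡 4, 𝓡 4⟯ Metric.sphere (0 : EuclideanSpace ℝ (Fin 5)) 1) := by
  intro M _ _ _ _ _ _ hyp
  obtain ⟨W₁, _, _, _, _, W₂, _, _, _, _, J₁, J₂, e₁, e₂, h1, h2, hcov, hL, hR, -, b₁, ⟨Θ₁⟩⟩ := hyp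
  exact nonempty_diffeomorph_sphere_four_of_steinBisection_of_diffeomorph hE hCerf M W₁ W₂ J₁ J₂
    e₁ e₂ h1 h2 hcov hL hR b₁ Θ₁

/-- **A Stein bisection with ONE ball certificate is `S⁴`, modulo Eliashberg (once) and Cerf.**
If a Hausdorff second countable smooth `4`-manifold `M` is covered by two smoothly embedded compact
Stein domains `(W₁, J₁)`, `(W₂, J₂)` meeting exactly along the images of both boundaries and the
first half carries a ball certificate `Φ₁ : W₁ ≅ 𝔻⁴`, then `M ≅ S⁴`: the certificate restricted
to the boundary makes a boundary datum of `W₁` diffeomorphic to `S³`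
(`exists_boundaryData_diffeomorph_sphere_three_of_diffeomorph_closedBall`), and
`nonempty_diffeomorph_sphere_four_of_steinBisection_of_diffeomorph` concludes (Eliashberg is
needed only for `W₂`).  Kervaire–Milnor (1963), §1; Eliashberg (1990), Thm. 5.1; Cerf (1968).
[cite: Eliashberg1990, Thm. 5.1] [cite: KervaireMilnor1963, §1] -/
theorem nonempty_diffeomorph_sphere_four_of_steinBisection_of_ballCertificate
    (hE : Eliashberg1990_steinFilling_sphere_three) (hCerf : cerf_twistedSphere_four)
    (M : Type) [TopologicalSpace M] [T2Space M] [SecondCountableTopology M]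
    [ChartedSpace (EuclideanSpace ℝ (Fin 4)) M] [IsManifold (𝓡 4) ∞ M]
    (W₁ : Type) [TopologicalSpace W₁] [ChartedSpace (EuclideanHalfSpace 4) W₁]
    [IsManifold (𝓡∂ 4) ∞ W₁] [CompactSpace W₁]
    (W₂ : Type) [TopologicalSpace W₂] [ChartedSpace (EuclideanHalfSpace 4) W₂]
    [IsManifold (𝓡∂ 4) ∞ W₂] [CompactSpace W₂]
    (J₁ : SteinStructure W₁) (J₂ : SteinStructure W₂) (e₁ : W₁ → M) (e₂ : W₂ → M)
    (h1 : Manifold.IsSmoothEmbedding (𝓡∂ 4) (𝓡 4) ∞ e₁)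
    (h2 : Manifold.IsSmoothEmbedding (𝓡∂ 4) (𝓡 4) ∞ e₂)
    (hcov : Set.range e₁ ∪ Set.range e₂ = Set.univ)
    (hL : Set.range e₁ ∩ Set.range e₂ = e₁ '' (𝓡∂ 4).boundary W₁)
    (hR : Set.range e₁ ∩ Set.range e₂ = e₂ '' (𝓡∂ 4).boundary W₂)
    (Φ₁ : W₁ ≃ₘ⟮𝓡∂ 4, 𝓡∂ 4⟯ Metric.closedBall (0 : EuclideanSpace ℝ (Fin 4)) 1) :
    Nonempty (M ≃ₘ⟮𝓡 4, 𝓡 4⟯ Metric.sphere (0 : EuclideanSpace ℝ (Fin 5)) 1) := by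
  -- `W₁` is Hausdorff and second countable (embedded in `M`); a boundary datum of `W₁`
  haveI : T2Space W₁ := h1.isEmbedding.t2Space
  haveI : SecondCountableTopology W₁ := h1.isEmbedding.secondCountableTopology
  obtain ⟨b₁⟩ : Nonempty (BoundaryData (𝓡∂ 4) W₁ (𝓡 3)) := nonempty_boundaryData_holds 3 W₁
  exact nonempty_diffeomorph_sphere_four_of_steinBisection_of_diffeomorph hE hCerf M W₁ W₂ J₁ J₂
    e₁ e₂ h1 h2 hcov hL hR b₁ (b₁.restrictDiffeomorph (closedBallBoundaryData 3) Φ₁)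

/-! ### Unconditional comparisons -/

/-- **`SphereSeamStandard` implies `SmoothSphereSeamStandard`** (pure topology, no facts).  The
older support item of the route asks only for a seam HOMEOMORPHIC to `S³`; a boundary datum `b` of
`W₁` is a topological embedding onto `∂W₁` (`b.range_incl`), so a diffeomorphism `b.carrier ≅ S³`
yields `∂W₁ ≃ₜ b.carrier ≃ₜ S³`, and the rest of the witness is passed on unchanged.  The
conclusion is, token for token, the signature of item stmt-SmoothPoincare4-15001. [folklore] -/
theorem smoothSphereSeamStandard_of_sphereSeamStandard
    (h : Summit.SmoothPoincare4.SmoothPoincare4.Theses.ConvexBisection.SphereSeamStandard) :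
    ∀ (M : Type) [TopologicalSpace M] [T2Space M] [SecondCountableTopology M]
      [ChartedSpace (EuclideanSpace ℝ (Fin 4)) M] [IsManifold (𝓡 4) ∞ M],
      M ≃ₕ Metric.sphere (0 : EuclideanSpace ℝ (Fin 5)) 1 →
      (∃ (W₁ : Type) (_ : TopologicalSpace W₁) (_ : ChartedSpace (EuclideanHalfSpace 4) W₁)
          (_ : IsManifold (𝓡∂ 4) ∞ W₁) (_ : CompactSpace W₁) (W₂ : Type) (_ : TopologicalSpace W₂)
          (_ : ChartedSpace (EuclideanHalfSpace 4) W₂) (_ : IsManifold (𝓡∂ 4) ∞ W₂)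
          (_ : CompactSpace W₂) (J₁ : Literature.Geometry.Symplectic.SteinStructure W₁)
          (J₂ : Literature.Geometry.Symplectic.SteinStructure W₂) (e₁ : W₁ → M) (e₂ : W₂ → M),
          Manifold.IsSmoothEmbedding (𝓡∂ 4) (𝓡 4) ∞ e₁ ∧
            Manifold.IsSmoothEmbedding (𝓡∂ 4) (𝓡 4) ∞ e₂ ∧
            Set.range e₁ ∪ Set.range e₂ = Set.univ ∧
            Set.range e₁ ∩ Set.range e₂ = e₁ '' (𝓡∂ 4).boundary W₁ ∧
            Set.range e₁ ∩ Set.range e₂ = e₂ '' (𝓡∂ 4).boundary W₂ ∧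
            (∀ w₁ w₂, e₁ w₁ = e₂ w₂ →
              Submodule.map (mfderiv (𝓡∂ 4) (𝓡 4) e₁ w₁).toLinearMap
                  (Literature.Geometry.Symplectic.contactPlane J₁.J w₁) =
                Submodule.map (mfderiv (𝓡∂ 4) (𝓡 4) e₂ w₂).toLinearMap
                  (Literature.Geometry.Symplectic.contactPlane J₂.J w₂)) ∧
            (∃ b : Literature.Topology.FourManifolds.BoundaryData (𝓡∂ 4) W₁ (𝓡 3),
              Nonempty (b.carrier ≃ₘ⟮𝓡 3, 𝓡 3⟯ Metric.sphere (0 : EuclideanSpace ℝ (Fin 4)) 1))) →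
      Nonempty (M ≃ₘ⟮𝓡 4, 𝓡 4⟯ Metric.sphere (0 : EuclideanSpace ℝ (Fin 5)) 1) := by
  intro M _ _ _ _ _ hM hyp
  obtain ⟨W₁, _, _, _, _, W₂, _, _, _, _, J₁, J₂, e₁, e₂, h1, h2, hcov, hL, hR, hξ, b₁, ⟨Θ₁⟩⟩ :=
    hyp
  -- `∂W₁ ≃ₜ b₁.carrier ≃ₜ S³`
  have θ : ((𝓡∂ 4).boundary W₁) ≃ₜ Metric.sphere (0 : EuclideanSpace ℝ (Fin 4)) 1 :=
    (b₁.isSmoothEmbedding.isEmbedding.toHomeomorph.trans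
      (Homeomorph.setCongr b₁.range_incl)).symm.trans Θ₁.toHomeomorph
  exact h M hM ⟨W₁, _, _, _, _, W₂, _, _, _, _, J₁, J₂, e₁, e₂, h1, h2, hcov, hL, hR, hξ, ⟨θ⟩⟩

/-- **The summit statement implies `SmoothSphereSeamStandard`** (the item is refutable only by an
exotic `S⁴`): under `SmoothPoincare4` every Hausdorff second countable smooth `M ≃ₕ S⁴` is already
diffeomorphic to `S⁴`, whatever bisection it carries.  The conclusion is, token for token, the
signature of item stmt-SmoothPoincare4-15001. [folklore] -/
theorem smoothSphereSeamStandard_of_smoothPoincare4 (h : _root_.SmoothPoincare4) :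
    ∀ (M : Type) [TopologicalSpace M] [T2Space M] [SecondCountableTopology M]
      [ChartedSpace (EuclideanSpace ℝ (Fin 4)) M] [IsManifold (𝓡 4) ∞ M],
      M ≃ₕ Metric.sphere (0 : EuclideanSpace ℝ (Fin 5)) 1 →
      (∃ (W₁ : Type) (_ : TopologicalSpace W₁) (_ : ChartedSpace (EuclideanHalfSpace 4) W₁)
          (_ : IsManifold (𝓡∂ 4) ∞ W₁) (_ : CompactSpace W₁) (W₂ : Type) (_ : TopologicalSpace W₂)
          (_ : ChartedSpace (EuclideanHalfSpace 4) W₂) (_ : IsManifold (𝓡∂ 4) ∞ W₂)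
          (_ : CompactSpace W₂) (J₁ : Literature.Geometry.Symplectic.SteinStructure W₁)
          (J₂ : Literature.Geometry.Symplectic.SteinStructure W₂) (e₁ : W₁ → M) (e₂ : W₂ → M),
          Manifold.IsSmoothEmbedding (𝓡∂ 4) (𝓡 4) ∞ e₁ ∧
            Manifold.IsSmoothEmbedding (𝓡∂ 4) (𝓡 4) ∞ e₂ ∧
            Set.range e₁ ∪ Set.range e₂ = Set.univ ∧
            Set.range e₁ ∩ Set.range e₂ = e₁ '' (𝓡∂ 4).boundary W₁ ∧
            Set.range e₁ ∩ Set.range e₂ = e₂ '' (𝓡∂ 4).boundary W₂ ∧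
            (∀ w₁ w₂, e₁ w₁ = e₂ w₂ →
              Submodule.map (mfderiv (𝓡∂ 4) (𝓡 4) e₁ w₁).toLinearMap
                  (Literature.Geometry.Symplectic.contactPlane J₁.J w₁) =
                Submodule.map (mfderiv (𝓡∂ 4) (𝓡 4) e₂ w₂).toLinearMap
                  (Literature.Geometry.Symplectic.contactPlane J₂.J w₂)) ∧
            (∃ b : Literature.Topology.FourManifolds.BoundaryData (𝓡∂ 4) W₁ (𝓡 3),
              Nonempty (b.carrier ≃ₘ⟮𝓡 3, 𝓡 3⟯ Metric.sphere (0 : EuclideanSpace ℝ (Fin 4)) 1))) →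
      Nonempty (M ≃ₘ⟮𝓡 4, 𝓡 4⟯ Metric.sphere (0 : EuclideanSpace ℝ (Fin 5)) 1) :=
  fun M _ _ _ _ _ hM _ => h M inferInstance inferInstance hM

end Summit.SmoothPoincare4.SmoothPoincare4.Theorems

end
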